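import Mathlib
import Summits.NavierStokesRegularity.NavierStokesRegularity.Theorems.WakeRatchetTailRatchetRelayInverseBound
import Summits.NavierStokesRegularity.NavierStokesRegularity.Theorems.WakeRatchetTailRatchetRelayDecaySharp
import HarnessLib

/-!
# `WakeRatchet.TailRatchet` (stmt-NavierStokesRegularity-21808): the drain-bordered inverse maps `Y_{3/4}` into
# `X_{3/4}` with explicit constants (step G−1 of the continuation programme)

Support file for the crux `TailRatchet` (route `WakeRatchet`; MODEL lattice ODEs of Tao 2016 §1.2, §4 —
nothing in this file is a statement about the Navier–Stokes equations, and no item is closed here).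

Context (census of stmt-21808, programme R-glob, step G−1): `…RelayInverseBound.drain_bordered_inverse_bound`
controls the drain-bordered inverse `M⁻¹ : φ ↦ (h, ε)` in the critical class `e^{t/2}`.  With the bootstrap
`…RelayDecaySharp.pantograph_decay_three_quarters` the same inverse is bounded in the SUBCRITICAL class
`e^{3t/4}`, where the dilated quadratic term of the front forcing has decay to spare even at `s = 2`:

* `drain_bordered_inverse_bound_sharp` — `|φ| ≤ Ae^{3t/4}` ⇒ the bordered solution obeys `|ε| ≤ 474A`,
  `|h| ≤ 5500000·A·e^{3t/4}`, `|h'| ≤ 11100000·A·e^{3t/4}`;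
* `drain_bordered_difference_sharp` — the same for differences of two bordered solutions (by uniqueness).

HONEST FRAMING: bookkeeping of explicit constants; MODEL lattice only; the construction item and the crux
stay open; the lacunary branch does NOT refute `TailRatchet` (which needs `Λ → 1`).
-/

noncomputable section

set_option linter.dupNamespace false

namespace Summit.NavierStokesRegularity.NavierStokesRegularity.Theorems

namespace WakeRatchetRelayInverseBoundSharp

open MeasureTheory Set Filter Topology Real
open WakeRatchetRelayInverseBound WakeRatchetRelayDecaySharp WakeRatchetRelayBorderedGeneral

variable {φ : ℝ → ℝ} {A : ℝ}

/-- **THE DRAIN-BORDERED INVERSE IN THE `3/4` CLASS.**  For `φ` continuous with `|φ(t)| ≤ Ae^{3t/4}` on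
`t ≤ 0` there are `ε ∈ ℝ` and `h : ℝ → ℝ` (continuous, `h(0) = 0`, `h → 0` at `−∞`) with
`h' = 2e^{t/2}h(t/2) + φ − ε·8e^{3t}` on `t < 0` and `|ε| ≤ 474A`, `|h(t)| ≤ 5500000·A·e^{3t/4}`,
`|2e^{t/2}h(t/2) + (φ(t) − ε·8e^{3t})| ≤ 11100000·A·e^{3t/4}` (`t ≤ 0`).
[cite: Tao2016AveragedNS, §1.2 (dyadic model); cell vocabulary (drain-bordered linearisation at the relay profile; programme R-glob, step G−1)] -/
theorem drain_bordered_inverse_bound_sharp (hφ : Continuous φ)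
    (hA : ∀ t : ℝ, t ≤ 0 → |φ t| ≤ A * Real.exp (3 / 4 * t)) :
    ∃ ε : ℝ, ∃ h : ℝ → ℝ, Continuous h ∧ h 0 = 0 ∧ Tendsto h atBot (𝓝 0) ∧
      (∀ t : ℝ, t < 0 → HasDerivAt h
        (2 * Real.exp (t / 2) * h (t / 2) + (φ t - ε * (8 * Real.exp (3 * t)))) t) ∧
      |ε| ≤ 474 * A ∧
      (∀ t : ℝ, t ≤ 0 → |h t| ≤ 5500000 * A * Real.exp (3 / 4 * t)) ∧
      (∀ t : ℝ, t ≤ 0 → |2 * Real.exp (t / 2) * h (t / 2) + (φ t - ε * (8 * Real.exp (3 * t)))| ≤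
        11100000 * A * Real.exp (3 / 4 * t)) := by
  have hA0 : 0 ≤ A := by
    have := hA 0 le_rfl
    rw [mul_zero, Real.exp_zero, mul_one] at this
    exact (abs_nonneg _).trans this
  -- the critical-class bound applies
  have hA' : ∀ t : ℝ, t ≤ 0 → |φ t| ≤ A * Real.exp (t / 2) := fun t ht =>
    (hA t ht).trans (mul_le_mul_of_nonneg_left (Real.exp_le_exp.2 (by linarith)) hA0)
  obtain ⟨ε, h, hc, h0, hlim, hde, hε, hh, -⟩ := drain_bordered_inverse_bound hφ hA'
  -- bootstrap with the forcing `φ − ε·8e^{3t}` in the `3/4` class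
  have hfA : ∀ t : ℝ, t ≤ 0 → |φ t - ε * (8 * Real.exp (3 * t))| ≤ 3793 * A * Real.exp (3 / 4 * t) := by
    intro t ht
    have h3 : Real.exp (3 * t) ≤ Real.exp (3 / 4 * t) := Real.exp_le_exp.2 (by linarith)
    calc |φ t - ε * (8 * Real.exp (3 * t))| ≤ |φ t| + |ε * (8 * Real.exp (3 * t))| := abs_sub _ _
      _ = |φ t| + 8 * |ε| * Real.exp (3 * t) := by
          rw [abs_mul, abs_mul, abs_of_pos (Real.exp_pos _), show |(8 : ℝ)| = 8 by norm_num]; ring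
      _ ≤ A * Real.exp (3 / 4 * t) + 8 * (474 * A) * Real.exp (3 / 4 * t) := by
          refine add_le_add (hA t ht) ?_
          exact mul_le_mul (mul_le_mul_of_nonneg_left hε (by norm_num)) h3 (Real.exp_pos _).le
            (by positivity)
      _ = 3793 * A * Real.exp (3 / 4 * t) := by ring
  have hfc : Continuous (fun t : ℝ => φ t - ε * (8 * Real.exp (3 * t))) := by fun_prop
  have hfA' : ∀ t : ℝ, t ≤ 0 → |φ t - ε * (8 * Real.exp (3 * t))| ≤ 3793 * A * Real.exp (t / 2) :=
    fun t ht => (hfA t ht).trans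
      (mul_le_mul_of_nonneg_left (Real.exp_le_exp.2 (by linarith)) (by positivity))
  obtain ⟨hfi, -⟩ := weighted_integrable hfc hfA'
  have hB : ∀ t : ℝ, t ≤ 0 → |h t| ≤ 510000 * A := fun t ht =>
    (hh t ht).trans (by
      have : Real.exp (t / 2) ≤ 1 := Real.exp_le_one_iff.2 (by linarith)
      nlinarith)
  have hdec := fun t (ht : t ≤ 0) =>
    pantograph_decay_three_quarters hfA hfi hc.continuousOn hde hB hlim ht
  have hdec' := fun t (ht : t ≤ 0) =>
    pantograph_deriv_decay_three_quarters hfA hfi hc.continuousOn hde hB hlim ht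
  refine ⟨ε, h, hc, h0, hlim, hde, hε, fun t ht => ?_, fun t ht => ?_⟩
  · refine (hdec t ht).trans (mul_le_mul_of_nonneg_right ?_ (Real.exp_pos _).le)
    nlinarith
  · refine (hdec' t ht).trans (mul_le_mul_of_nonneg_right ?_ (Real.exp_pos _).le)
    nlinarith

/-- **LIPSCHITZ BOUND IN THE `3/4` CLASS.**  Two bounded normalised decaying bordered solutions with forcings
`φ₁, φ₂`, `|φ₁ − φ₂| ≤ A₁₂e^{3t/4}`, satisfy `|ε₁ − ε₂| ≤ 474A₁₂`, `|h₁ − h₂| ≤ 5500000·A₁₂·e^{3t/4}`,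
`|(h₁ − h₂)'| ≤ 11100000·A₁₂·e^{3t/4}` (`t ≤ 0`).
[cite: Tao2016AveragedNS, §1.2 (dyadic model); cell vocabulary (drain-bordered linearisation at the relay profile; programme R-glob, step G−1)] -/
theorem drain_bordered_difference_sharp {φ₁ φ₂ h₁ h₂ : ℝ → ℝ} {ε₁ ε₂ A₁₂ B₁ B₂ : ℝ}
    (hφ₁ : Continuous φ₁) (hφ₂ : Continuous φ₂)
    (hA : ∀ t : ℝ, t ≤ 0 → |φ₁ t - φ₂ t| ≤ A₁₂ * Real.exp (3 / 4 * t))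
    (hc₁ : ContinuousOn h₁ (Iic 0)) (hc₂ : ContinuousOn h₂ (Iic 0))
    (hd₁ : ∀ t : ℝ, t < 0 → HasDerivAt h₁
      (2 * Real.exp (t / 2) * h₁ (t / 2) + (φ₁ t - ε₁ * (8 * Real.exp (3 * t)))) t)
    (hd₂ : ∀ t : ℝ, t < 0 → HasDerivAt h₂
      (2 * Real.exp (t / 2) * h₂ (t / 2) + (φ₂ t - ε₂ * (8 * Real.exp (3 * t)))) t)
    (hB₁ : ∀ t : ℝ, t ≤ 0 → |h₁ t| ≤ B₁) (hB₂ : ∀ t : ℝ, t ≤ 0 → |h₂ t| ≤ B₂)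
    (h0₁ : h₁ 0 = 0) (h0₂ : h₂ 0 = 0)
    (hl₁ : Tendsto h₁ atBot (𝓝 0)) (hl₂ : Tendsto h₂ atBot (𝓝 0)) :
    |ε₁ - ε₂| ≤ 474 * A₁₂ ∧
      (∀ t : ℝ, t ≤ 0 → |h₁ t - h₂ t| ≤ 5500000 * A₁₂ * Real.exp (3 / 4 * t)) ∧
      (∀ t : ℝ, t ≤ 0 → |2 * Real.exp (t / 2) * (h₁ (t / 2) - h₂ (t / 2)) +
        ((φ₁ t - φ₂ t) - (ε₁ - ε₂) * (8 * Real.exp (3 * t)))| ≤ 11100000 * A₁₂ * Real.exp (3 / 4 * t)) := by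
  obtain ⟨ε, h, hc, h0, hlim, hde, hε, hh, hh'⟩ :=
    drain_bordered_inverse_bound_sharp (φ := fun t => φ₁ t - φ₂ t) (hφ₁.sub hφ₂) hA
  set d : ℝ → ℝ := fun t => h₁ t - h₂ t with hd_def
  have hdc : ContinuousOn d (Iic 0) := hc₁.sub hc₂
  have hdd : ∀ t : ℝ, t < 0 → HasDerivAt d
      (2 * Real.exp (t / 2) * d (t / 2) + ((φ₁ t - φ₂ t) - (ε₁ - ε₂) * (8 * Real.exp (3 * t)))) t := by
    intro t ht
    refine ((hd₁ t ht).sub (hd₂ t ht)).congr_deriv ?_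
    simp only [hd_def]; ring
  have hdB : ∀ t : ℝ, t ≤ 0 → |d t| ≤ B₁ + B₂ := fun t ht => by
    simp only [hd_def]; exact (abs_sub _ _).trans (add_le_add (hB₁ t ht) (hB₂ t ht))
  have hd0 : d 0 = 0 := by simp [hd_def, h0₁, h0₂]
  have hdl : Tendsto d atBot (𝓝 0) := by simpa using hl₁.sub hl₂
  have hA0 : 0 ≤ A₁₂ := by
    have := hA 0 le_rfl
    rw [mul_zero, Real.exp_zero, mul_one] at this
    exact (abs_nonneg _).trans this
  have hhB : ∀ t : ℝ, t ≤ 0 → |h t| ≤ 5500000 * A₁₂ := fun t ht =>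
    (hh t ht).trans (by
      have : Real.exp (3 / 4 * t) ≤ 1 := Real.exp_le_one_iff.2 (by linarith)
      nlinarith)
  obtain ⟨hεeq, hdeq⟩ := drain_bordered_unique (f := fun t => φ₁ t - φ₂ t) hdc hc.continuousOn hdd hde
    hdB hhB hd0 h0 hdl hlim
  refine ⟨by rw [hεeq]; exact hε, fun t ht => ?_, fun t ht => ?_⟩
  · have := hdeq t ht
    simp only [hd_def] at this
    rw [this]; exact hh t ht
  · have h1 := hdeq t ht
    have h2 := hdeq (t / 2) (by linarith)
    simp only [hd_def] at h1 h2
    rw [h2, hεeq]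
    exact hh' t ht

end WakeRatchetRelayInverseBoundSharp

end Summit.NavierStokesRegularity.NavierStokesRegularity.Theorems

end
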